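import Literature.Computability.Cryptography.ShorAssemblyLeavesProofs
import Literature.Computability.QuantumComplexity.PromiseWrap
import HarnessLib

/-!
# Promise problems decided by randomised polynomial-time machines with one `BQP` oracle

Family `PQC`; a corollary of the classical-base principle `isQSolvable_of_mem_FPRel_BQP`
(`ShorAssemblyClassicalBase.lean`, discharged as `isQSolvable_of_mem_FPRel_BQP_holds`: "`BPP^{BQP}`
search problems with an extension-closed relation and coin success `≥ 3/4` are in `FBQP`",
Bennett–Bernstein–Brassard–Vazirani 1997, Cor. 4.15 with Bernstein–Vazirani 1997, Thm. 8.3) and of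
the promise wrap `mem_PromiseBQP_of_isQSolvable` (`PromiseWrap.lean`, Watrous 2009, §III.2):

* `mem_PromiseBQP_of_FPRel_decider` — **if `A ∈ BQP` and a polynomial-time oracle machine
  `G ∈ FP^A` with `q(|x|)` uniform coins outputs a string starting with `1` with probability `≥ 3/4`
  on every yes-instance and starting with `0` with probability `≥ 3/4` on every no-instance of a
  disjoint promise problem `Q`, then `Q ∈ PromiseBQP`.** The relation "the first output bit is the
  correct verdict on the promise (anything off the promise)" is closed under extension, so the
  principle applies; the wrap reads that bit on wire `0`.

This is the form in which "a `BPP` sampler with a quantum subroutine decides a promise problem"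
is consumed (e.g. torsion-witness samplers over class groups: Shor factoring and one order
computation per sample behind a single join oracle `FACT ⊕ B`, `oracleJoin_mem_BQP`).

## References

* C. H. Bennett, E. Bernstein, G. Brassard, U. Vazirani, *Strengths and weaknesses of quantum
  computing*, SIAM J. Comput. 26 (1997) 1510–1523, Thm. 4.14 and Cor. 4.15
  [BennettBernsteinBrassardVazirani1997].
* J. Watrous, *Quantum computational complexity*, Encyclopedia of Complexity and Systems Science
  (2009), §III.2 (promise problems and `BQP`) [Watrous2009].
-/

noncomputable section

namespace Literature.Computability.Cryptography

open _root_.Computability Complexity QuantumComplexity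

/-- **`BPP^{A}` promise deciders with `A ∈ BQP` give `PromiseBQP`.** If `A ∈ BQP`, `G ∈ FP^A`
(`FPRel (Oracle.ofLanguage A)`, reading its coins from the second component of its input `⟨x, c⟩`),
and with probability `≥ 3/4` over `c ∈ {0,1}^{q(|x|)}` the output of `G` starts with `1` for every
yes-instance `x` and with `0` for every no-instance `x` of a promise problem `Q` with disjoint parts,
then `Q ∈ PromiseBQP`: `isQSolvable_of_mem_FPRel_BQP_holds` on the extension-closed relation "the
first output bit is the correct verdict on the promise", then `mem_PromiseBQP_of_isQSolvable` with
the projection `sndF` reading that bit. [cite: BennettBernsteinBrassardVazirani1997, Cor. 4.15 (BQP^BQP = BQP) with Thm. 4.14] -/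
theorem mem_PromiseBQP_of_FPRel_decider (Q : PromiseProblem) (hQ : Disjoint Q.yes Q.no)
    {A : Language Bool} (hA : A ∈ BQP) (G : List Bool → List Bool) (q : Polynomial ℕ)
    (hG : G ∈ FPRel (Oracle.ofLanguage A))
    (hyes : ∀ x ∈ Q.yes, 3 / 4 ≤ uniformProb (q.eval x.length) {c | [true] <+: G (boolPair x c)})
    (hno : ∀ x ∈ Q.no, 3 / 4 ≤ uniformProb (q.eval x.length) {c | [false] <+: G (boolPair x c)}) :
    Q ∈ PromiseBQP := by
  classical
  -- the relation: the correct verdict bit on the promise, anything off the promise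
  let R : List Bool → Set (List Bool) := fun x =>
    {z | (x ∈ Q.yes → [true] <+: z) ∧ (x ∈ Q.no → [false] <+: z)}
  have hRext : ∀ x, ∀ y ∈ R x, ∀ z, y <+: z → z ∈ R x := fun x y hy z hyz =>
    ⟨fun hx => (hy.1 hx).trans hyz, fun hx => (hy.2 hx).trans hyz⟩
  have hR : IsQSolvable R := by
    refine isQSolvable_of_mem_FPRel_BQP_holds A G q R hRext hA hG fun x => ?_
    by_cases hxy : x ∈ Q.yes
    · have hxn : x ∉ Q.no := Set.disjoint_left.1 hQ hxy
      refine (hyes x hxy).trans (uniformProb_mono _ fun c hc => ?_)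
      exact ⟨fun _ => hc, fun h => absurd h hxn⟩
    · by_cases hxn : x ∈ Q.no
      · refine (hno x hxn).trans (uniformProb_mono _ fun c hc => ?_)
        exact ⟨fun h => absurd h hxy, fun _ => hc⟩
      · have huniv : {c | G (boolPair x c) ∈ R x} = Set.univ :=
          Set.eq_univ_of_forall fun c => ⟨fun h => absurd h hxy, fun h => absurd h hxn⟩
        rw [huniv, uniformProb_univ]
        norm_num
  refine mem_PromiseBQP_of_isQSolvable Q (fun w => w) Brick.sndF (PolyTimeComputable.id _)
    Brick.sndF_mem_FP hR ?_ ?_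
  · intro x hx y hy
    rw [Brick.sndF_boolPair]
    exact hy.1 hx
  · intro x hx y hy
    rw [Brick.sndF_boolPair]
    exact hy.2 hx

/-- **One-sided variant** (the shape of torsion-witness tests: no false positives): if on every
no-instance the first output bit is `0` for EVERY coin string, the no-side hypothesis holds with
probability `1`. [cite: Watrous2009, §III.2] -/
theorem mem_PromiseBQP_of_FPRel_decider_oneSided (Q : PromiseProblem) (hQ : Disjoint Q.yes Q.no)
    {A : Language Bool} (hA : A ∈ BQP) (G : List Bool → List Bool) (q : Polynomial ℕ)
    (hG : G ∈ FPRel (Oracle.ofLanguage A))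
    (hyes : ∀ x ∈ Q.yes, 3 / 4 ≤ uniformProb (q.eval x.length) {c | [true] <+: G (boolPair x c)})
    (hno : ∀ x ∈ Q.no, ∀ c : List Bool, [false] <+: G (boolPair x c)) :
    Q ∈ PromiseBQP := by
  refine mem_PromiseBQP_of_FPRel_decider Q hQ hA G q hG hyes fun x hx => ?_
  have huniv : {c | [false] <+: G (boolPair x c)} = Set.univ :=
    Set.eq_univ_of_forall fun c => hno x hx c
  rw [huniv, uniformProb_univ]
  norm_num

end Literature.Computability.Cryptography

end
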